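import Mathlib
import Summits.NavierStokesRegularity.NavierStokesRegularity.Theorems.FilamentSkeletonRssSkeletonJ1RLiaThirdDerivative
import Summits.NavierStokesRegularity.NavierStokesRegularity.Theorems.FilamentSkeletonRssSkeletonJ1RLiaThirdDerivLipschitzForm
import Summits.NavierStokesRegularity.NavierStokesRegularity.Theorems.FilamentSkeletonRssSkeletonJ1RLiaAmbientFDerivBound
import Summits.NavierStokesRegularity.NavierStokesRegularity.Theorems.FilamentSkeletonRssSkeletonJ1RLiaAmbientPathSecondDeriv
import Summits.NavierStokesRegularity.NavierStokesRegularity.Theorems.FilamentSkeletonRssSkeletonJ1RLiaSelfSplit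

/-!
# Crux `SkeletonJ1R` (stmt-NavierStokesRegularity-23610) · line `streamline_kantorovich_R` · toward stub F2-d (`LiaDefectDerivBL`, v7), brick S4′b for B1′:
# `x‴` OF THE LIA REFERENCE IS BOUNDED AND LIPSCHITZ ON A WINDOW — explicit `H`, `H′` from window data

Hand `leafhand-ns-filamentskeletonrs-1` (gen 0), `--supports stmt-NavierStokesRegularity-23610 --as helper`.  MODEL rung, NEGATIVE side of the ladder:
calculus for a HYPOTHETICAL filament-type blow-up skeleton; nothing here is a claim about Navier–Stokes regularity; the stub and the crux stay OPEN.

`IsLiaReference.thirdDeriv_window_bounds`: for THE local-induction reference `x_j` and a window `|r − τ| ≤ R` on which `‖x_j r‖ ≤ Xm`, `‖x_j″ r‖ ≤ κw` and every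
partner datum line is at perpendicular distance `≥ d > 0`, with `|χ′| ≤ Cφ`, `χ′` `D₂`-Lipschitz (`χ = Real.smoothTransition`), `ℓ = Rb√(Γ log Γ) > 0`:
the vector `Z r` of `…LiaThirdDerivative.IsLiaReference.hasDerivAt_deriv_deriv_global` (`= x_j‴ r`) satisfies, for `|p−τ|, |q−τ| ≤ R`,
`‖Z p‖ ≤ H` and `‖Z p − Z q‖ ≤ H′|p − q|` with
`H = |β⁻¹|(A₁M + L + κw M)`, `H′ = |β⁻¹|(ΛM + 2A₁(κw M + L) + (2κw L + L₂ + HM))`, `A₁ = 2CφXm/ℓ²`, `Λ = D₂(2Xm/ℓ²)² + 2Cφ(1 + Xm κw)/ℓ²`,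
`M = B_d + (½+|α|)Xm`, `L = Σ_{k≠j}|Γγ_k/4π|·24/d² + (½+|α|)`, `L₂ = Σ|Γγ_k/4π|(28/d³ + 6κw/d²) + (½+|α|)κw`, `B_d = Σ|Γγ_k/4π|·2/d`
— assembled by `…LiaThirdDerivLipschitzForm.norm_thirdDerivForm_sub_le` from the factor bounds (cutoff: `hasDerivAt_switchWeight_comp`; ambient field:
`norm_ambientField_le`, `norm_ambientField_sub_le`, `norm_fderiv_ambientField_le`, `…LiaAmbientPathSecondDeriv`; mean-value inequalities).  These are the
`hZH`/`hZlip` inputs of `…LiaSelfDerivEstimate.symmDerivStrand_sub_lia_le` (S4′c instantiates `Xm ≍ ℓ`, `κw ≍ κ_R`, `d = ρ√Γ/2`).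
-/

set_option linter.dupNamespace false -- `NavierStokesRegularity.NavierStokesRegularity` path/namespace repetition is the tree convention

noncomputable section

namespace Summit.NavierStokesRegularity.NavierStokesRegularity.Theorems.SkeletonJ1RFrame

open Set Function Filter MeasureTheory Real Topology
open Literature.Analysis.FluidPDE
open Summit.NavierStokesRegularity.NavierStokesRegularity.Theorems.SkeletonJ1RLiaSelf (contDiff_one_deriv norm_deriv_sub_deriv_le_on)
open scoped InnerProductSpace BigOperators

variable {N : ℕ} {Γ Rb : ℝ} {p t : Fin N → EuclideanSpace ℝ (Fin 3)} {γ : Fin N → ℝ} {α : ℝ} {s₀ : Fin N → ℝ}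
  {x : Fin N → ℝ → EuclideanSpace ℝ (Fin 3)}

/-- A real function with derivative bounded by `C` on `[[a, b]]` moves by at most `C|a − b|` (mean value, packaged). [folklore] -/
theorem abs_sub_le_of_hasDerivAt_bound {f f' : ℝ → ℝ} {C a b : ℝ} (hf : ∀ r ∈ uIcc a b, HasDerivAt f (f' r) r)
    (hb : ∀ r ∈ uIcc a b, |f' r| ≤ C) : |f a - f b| ≤ C * |a - b| := by
  have h := Convex.norm_image_sub_le_of_norm_hasDerivWithin_le (fun r hr => (hf r hr).hasDerivWithinAt)
    (fun r hr => by rw [Real.norm_eq_abs]; exact hb r hr) (convex_uIcc a b) right_mem_uIcc left_mem_uIcc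
  rwa [Real.norm_eq_abs, Real.norm_eq_abs] at h

/-- A vector function with derivative bounded by `C` on `[[a, b]]` moves by at most `C|a − b|`. [folklore] -/
theorem norm_sub_le_of_hasDerivAt_bound {f f' : ℝ → EuclideanSpace ℝ (Fin 3)} {C a b : ℝ} (hf : ∀ r ∈ uIcc a b, HasDerivAt f (f' r) r)
    (hb : ∀ r ∈ uIcc a b, ‖f' r‖ ≤ C) : ‖f a - f b‖ ≤ C * |a - b| := by
  have h := Convex.norm_image_sub_le_of_norm_hasDerivWithin_le (fun r hr => (hf r hr).hasDerivWithinAt)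
    hb (convex_uIcc a b) right_mem_uIcc left_mem_uIcc
  rwa [Real.norm_eq_abs] at h

/-- A vector function differentiable on `[[a, b]]` with `‖deriv f‖ ≤ C` there moves by at most `C|a − b|`. [folklore] -/
theorem norm_sub_le_of_deriv_bound {f : ℝ → EuclideanSpace ℝ (Fin 3)} {C a b : ℝ} (hf : ∀ r ∈ uIcc a b, DifferentiableAt ℝ f r)
    (hb : ∀ r ∈ uIcc a b, ‖deriv f r‖ ≤ C) : ‖f a - f b‖ ≤ C * |a - b| :=
  norm_sub_le_of_hasDerivAt_bound (f' := deriv f) (fun r hr => (hf r hr).hasDerivAt) hb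

set_option maxHeartbeats 1600000 in
/-- **`x‴` of the LIA reference: window bound `H` and window Lipschitz constant `H′`** (module docstring). [folklore] -/
theorem IsLiaReference.thirdDeriv_window_bounds (hx : IsLiaReference Γ Rb p t γ α s₀ x) (ht : ∀ k, ‖t k‖ = 1) (j : Fin N)
    {τ R d Xm κw Cφ D₂ : ℝ} (hd : 0 < d) (hXm : 0 ≤ Xm) (hκw : 0 ≤ κw) (hD₂ : 0 ≤ D₂)
    (hCφ : ∀ r : ℝ, |deriv Real.smoothTransition r| ≤ Cφ)
    (hD₂lip : ∀ a b : ℝ, |deriv Real.smoothTransition a - deriv Real.smoothTransition b| ≤ D₂ * |a - b|)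
    (hℓ : 0 < Rb * Real.sqrt (Γ * Real.log Γ))
    (hXw : ∀ r, |r - τ| ≤ R → ‖x j r‖ ≤ Xm) (hκww : ∀ r, |r - τ| ≤ R → ‖deriv (deriv (x j)) r‖ ≤ κw)
    (hfar : ∀ r, |r - τ| ≤ R → ∀ k, k ≠ j →
      d ^ 2 ≤ ‖x j r - waistPt Γ p t s₀ k‖ ^ 2 - (inner ℝ (x j r - waistPt Γ p t s₀ k) (t k)) ^ 2)
    {a b : ℝ} (ha : |a - τ| ≤ R) (hb : |b - τ| ≤ R) :
    let ℓ := Rb * Real.sqrt (Γ * Real.log Γ)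
    let bβ := |(liaCoeff Γ γ j)⁻¹|
    let A₁ := Cφ * (2 * Xm / ℓ ^ 2)
    let Λ := D₂ * (2 * Xm / ℓ ^ 2) ^ 2 + Cφ * (2 * (1 + Xm * κw) / ℓ ^ 2)
    let Q := 1 / 2 + |α|
    let M := (∑ k ∈ Finset.univ.erase j, |Γ * γ k / (4 * Real.pi)| * (2 / d)) + Q * Xm
    let L := (∑ k ∈ Finset.univ.erase j, |Γ * γ k / (4 * Real.pi)| * (6 / (d / 2) ^ 2)) + Q
    let L₂ := (∑ k ∈ Finset.univ.erase j, |Γ * γ k / (4 * Real.pi)| * (28 / d ^ 3 + 6 * κw / d ^ 2)) + Q * κw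
    let H := bβ * (A₁ * M + L + κw * M)
    let Z : ℝ → EuclideanSpace ℝ (Fin 3) := fun r =>
      ((liaCoeff Γ γ j)⁻¹ * (deriv Real.smoothTransition (1 - (‖x j r‖ ^ 2 / ℓ ^ 2 + 1 - 2 * (3 / 2 : ℝ))) *
            (-(2 * ⟪x j r, deriv (x j) r⟫_ℝ / ℓ ^ 2)))) • cross (deriv (x j) r) (ambientField Γ p t γ α s₀ j (x j r)) +
        ((liaCoeff Γ γ j)⁻¹ * refCutoff ℓ (x j r)) •
          (cross (deriv (x j) r) (fderiv ℝ (ambientField Γ p t γ α s₀ j) (x j r) (deriv (x j) r)) +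
            cross (deriv (deriv (x j)) r) (ambientField Γ p t γ α s₀ j (x j r)))
    ‖Z a‖ ≤ H ∧ ‖Z a - Z b‖ ≤ bβ * (Λ * M + 2 * A₁ * (κw * M + L) + (2 * κw * L + L₂ + H * M)) * |a - b| := by
  intro ℓ bβ A₁ Λ Q M L L₂ H Z
  obtain ⟨hC2, hunit, -, -, hode⟩ := hx j
  set W := ambientField Γ p t γ α s₀ j with hW
  set c : Fin N → ℝ := fun k => Γ * γ k / (4 * Real.pi) with hc
  have hCφ0 : 0 ≤ Cφ := (abs_nonneg _).trans (hCφ 0)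
  have hQ0 : 0 ≤ Q := by positivity
  have hℓ2 : 0 < ℓ ^ 2 := by positivity
  have hA₁0 : 0 ≤ A₁ := by positivity
  have hBd0 : 0 ≤ ∑ k ∈ Finset.univ.erase j, |Γ * γ k / (4 * Real.pi)| * (2 / d) := Finset.sum_nonneg fun k _ => by positivity
  have hM0 : 0 ≤ M := by positivity
  have hL0 : 0 ≤ L := by
    have : 0 ≤ ∑ k ∈ Finset.univ.erase j, |Γ * γ k / (4 * Real.pi)| * (6 / (d / 2) ^ 2) := Finset.sum_nonneg fun k _ => by positivity
    positivity
  have hΛ0 : 0 ≤ Λ := by positivity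
  -- the segment lies in the window
  have hR0 : 0 ≤ R := (abs_nonneg _).trans ha
  have hseg : ∀ r ∈ uIcc a b, |r - τ| ≤ R := by
    intro r hr
    rcases mem_uIcc.1 hr with ⟨h1, h2⟩ | ⟨h1, h2⟩ <;> [skip; skip] <;>
    · rw [abs_le] at ha hb ⊢; constructor <;> linarith [ha.1, ha.2, hb.1, hb.2]
  -- basic differentiability along the curve
  have hp : ∀ r, HasDerivAt (x j) (deriv (x j) r) r := fun r => ((hC2.differentiable (by norm_num)) r).hasDerivAt
  have hT : ∀ r, HasDerivAt (deriv (x j)) (deriv (deriv (x j)) r) r := fun r =>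
    (((contDiff_one_deriv hC2).differentiable one_ne_zero) r).hasDerivAt
  have hWd : Differentiable ℝ W := (contDiff_ambientField Γ p t γ α s₀ ht j (n := 1)).differentiable one_ne_zero
  -- factor bounds at window points
  have hWM : ∀ r, |r - τ| ≤ R → ‖W (x j r)‖ ≤ M := fun r hr =>
    (norm_ambientField_le Γ p t γ α s₀ ht j (x j r) hd (hfar r hr)).trans (by
      show _ ≤ (∑ k ∈ Finset.univ.erase j, |Γ * γ k / (4 * Real.pi)| * (2 / d)) + (1 / 2 + |α|) * Xm
      have := hXw r hr; gcongr)
  have hDW : ∀ r, |r - τ| ≤ R → ‖fderiv ℝ W (x j r)‖ ≤ L := fun r hr => norm_fderiv_ambientField_le Γ p t γ α s₀ ht j hd (hfar r hr)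
  have hW1 : ∀ r, |r - τ| ≤ R → ‖fderiv ℝ W (x j r) (deriv (x j) r)‖ ≤ L := fun r hr => by
    have h := (fderiv ℝ W (x j r)).le_opNorm (deriv (x j) r)
    rw [hunit r, mul_one] at h
    exact h.trans (hDW r hr)
  have hφ01 : ∀ r, |refCutoff ℓ (x j r)| ≤ 1 := fun r => by
    have h := refCutoff_mem_Icc ℓ (x j r); rw [abs_of_nonneg h.1]; exact h.2
  -- the cutoff derivative φ₁(r) and its bound A₁
  have hφ₁b : ∀ r, |r - τ| ≤ R → |deriv Real.smoothTransition (1 - (‖x j r‖ ^ 2 / ℓ ^ 2 + 1 - 2 * (3 / 2 : ℝ))) *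
      (-(2 * ⟪x j r, deriv (x j) r⟫_ℝ / ℓ ^ 2))| ≤ A₁ := by
    intro r hr
    rw [abs_mul, abs_neg, abs_div, abs_of_pos hℓ2, abs_mul, abs_two]
    have hin : |⟪x j r, deriv (x j) r⟫_ℝ| ≤ ‖x j r‖ := by
      have := abs_real_inner_le_norm (x j r) (deriv (x j) r); rwa [hunit r, mul_one] at this
    have h1 := hCφ (1 - (‖x j r‖ ^ 2 / ℓ ^ 2 + 1 - 2 * (3 / 2 : ℝ)))
    have h2 : 2 * |⟪x j r, deriv (x j) r⟫_ℝ| / ℓ ^ 2 ≤ 2 * Xm / ℓ ^ 2 :=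
      div_le_div_of_nonneg_right (by linarith [hin, hXw r hr]) hℓ2.le
    show _ ≤ Cφ * (2 * Xm / ℓ ^ 2)
    exact mul_le_mul h1 h2 (by positivity) hCφ0
  -- ‖Z r‖ ≤ H on the window
  have hZH : ∀ r, |r - τ| ≤ R → ‖Z r‖ ≤ H := by
    intro r hr
    have h := hx.norm_thirdDeriv_le j r hCφ hℓ.ne'
    refine h.trans ?_
    show bβ * _ ≤ bβ * (A₁ * M + L + κw * M)
    refine mul_le_mul_of_nonneg_left ?_ (abs_nonneg _)
    have i1 : Cφ * (2 * ‖x j r‖ / ℓ ^ 2) * ‖W (x j r)‖ ≤ A₁ * M := by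
      have : Cφ * (2 * ‖x j r‖ / ℓ ^ 2) ≤ A₁ := by
        show _ ≤ Cφ * (2 * Xm / ℓ ^ 2)
        exact mul_le_mul_of_nonneg_left (div_le_div_of_nonneg_right (by linarith [hXw r hr]) hℓ2.le) hCφ0
      exact mul_le_mul this (hWM r hr) (norm_nonneg _) hA₁0
    have i2 := hW1 r hr
    have i3 : ‖deriv (deriv (x j)) r‖ * ‖W (x j r)‖ ≤ κw * M := mul_le_mul (hκww r hr) (hWM r hr) (norm_nonneg _) hκw
    linarith
  refine ⟨hZH a ha, ?_⟩
  -- Lipschitz bounds of the factors on [[a, b]]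
  set δ := |a - b| with hδ
  have hδ0 : 0 ≤ δ := abs_nonneg _
  -- (T) tangent
  have hTd : ‖deriv (x j) a - deriv (x j) b‖ ≤ κw * δ :=
    norm_deriv_sub_deriv_le_on hC2 (τ := b) (σ := a) fun r hr => hκww r (hseg r (uIcc_comm a b ▸ hr))
  -- (K) curvature vector: derivative Z, bound H
  have hKd : ‖deriv (deriv (x j)) a - deriv (deriv (x j)) b‖ ≤ H * δ :=
    norm_sub_le_of_hasDerivAt_bound (f' := Z) (fun r _ => hx.hasDerivAt_deriv_deriv_global ht j r) fun r hr => hZH r (hseg r hr)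
  -- (W) ambient field along the curve
  have hxab : ‖x j a - x j b‖ ≤ δ := by
    have hdd : Differentiable ℝ (x j) := hC2.differentiable (by norm_num)
    have h := Convex.norm_image_sub_le_of_norm_deriv_le (f := x j) (C := 1) (s := Set.univ) (fun y _ => hdd y)
      (fun y _ => (hunit y).le) convex_univ (Set.mem_univ b) (Set.mem_univ a)
    rwa [one_mul, Real.norm_eq_abs] at h
  have hWdiff : ‖W (x j a) - W (x j b)‖ ≤ L * δ := by
    have h := norm_ambientField_sub_le Γ p t γ α s₀ ht j hd (hfar a ha) (hfar b hb)
    refine h.trans ?_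
    have hcoef : (∑ k ∈ Finset.univ.erase j, |Γ*γ k/(4*Real.pi)| * (6 / d ^ 2)) + (1/2 + |α|) ≤ L := by
      show _ ≤ (∑ k ∈ Finset.univ.erase j, |Γ * γ k / (4 * Real.pi)| * (6 / (d / 2) ^ 2)) + Q
      refine add_le_add (Finset.sum_le_sum fun k _ => mul_le_mul_of_nonneg_left ?_ (abs_nonneg _)) le_rfl
      rw [div_le_div_iff₀ (by positivity) (by positivity)]; nlinarith [hd]
    exact mul_le_mul hcoef hxab (norm_nonneg _) hL0
  -- (W₁) DW·x′ along the curve: closed form, derivative, bound L₂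
  have hW1d : ‖fderiv ℝ W (x j a) (deriv (x j) a) - fderiv ℝ W (x j b) (deriv (x j) b)‖ ≤ L₂ * δ := by
    have hfun : ∀ r, fderiv ℝ W (x j r) (deriv (x j) r) =
        (∑ k ∈ Finset.univ.erase j, (Γ * γ k / (4 * Real.pi)) •
          ((-(2 * (2 * ⟪x j r - waistPt Γ p t s₀ k, deriv (x j) r⟫_ℝ - 2 * ⟪x j r - waistPt Γ p t s₀ k, t k⟫_ℝ * ⟪deriv (x j) r, t k⟫_ℝ)) /
                (‖x j r - waistPt Γ p t s₀ k‖ ^ 2 - ⟪x j r - waistPt Γ p t s₀ k, t k⟫_ℝ ^ 2 +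
                  Real.exp (-(1+Real.eulerMascheroniConstant-Real.log 2)) * (1:ℝ)) ^ 2) • cross (t k) (x j r - waistPt Γ p t s₀ k) +
            (2 / (‖x j r - waistPt Γ p t s₀ k‖ ^ 2 - ⟪x j r - waistPt Γ p t s₀ k, t k⟫_ℝ ^ 2 +
                Real.exp (-(1+Real.eulerMascheroniConstant-Real.log 2)) * (1:ℝ))) • cross (t k) (deriv (x j) r))) +
          ((1/2:ℝ) • deriv (x j) r - α • cross (EuclideanSpace.single 2 1) (deriv (x j) r)) := fun r =>
      fderiv_ambientField_apply_eq_pathDeriv Γ p t γ α s₀ ht j (hp r)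
    have heq := funext hfun
    refine norm_sub_le_of_deriv_bound (f := fun r' => fderiv ℝ W (x j r') (deriv (x j) r')) (fun r _ => ?_) (fun r hr => ?_)
    · rw [heq]; exact (hasDerivAt_ambientPathDeriv Γ p t γ α s₀ ht j (hp r) (hT r)).differentiableAt
    · rw [heq, (hasDerivAt_ambientPathDeriv Γ p t γ α s₀ ht j (hp r) (hT r)).deriv]
      exact norm_ambientPathSecondDeriv_le Γ p t γ α s₀ ht j hd (hunit r).le (hκww r (hseg r hr)) (hfar r (hseg r hr))
  -- (a₀) the cutoff along the curve
  have ha₀d : |refCutoff ℓ (x j a) - refCutoff ℓ (x j b)| ≤ A₁ * δ :=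
    abs_sub_le_of_hasDerivAt_bound (fun r _ => by
      have h := hasDerivAt_switchWeight_comp (ℓ := ℓ) (s := (3/2:ℝ)) (hp r)
      exact h) fun r hr => hφ₁b r (hseg r hr)
  -- (a₁) the cutoff derivative φ₁ = χ′(g)·g′
  set g : ℝ → ℝ := fun r => 1 - (‖x j r‖ ^ 2 / ℓ ^ 2 + 1 - 2 * (3 / 2 : ℝ)) with hg
  set g' : ℝ → ℝ := fun r => -(2 * ⟪x j r, deriv (x j) r⟫_ℝ / ℓ ^ 2) with hg'
  have hgd : ∀ r, HasDerivAt g (g' r) r := fun r => by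
    have h1 : HasDerivAt (fun r' => ‖x j r'‖ ^ 2) (2 * ⟪x j r, deriv (x j) r⟫_ℝ) r := (hp r).norm_sq
    have h2 := (((h1.div_const (ℓ ^ 2)).add_const 1).sub_const (2 * (3/2:ℝ))).const_sub 1
    simpa [hg, hg'] using h2
  have hg'b : ∀ r, |r - τ| ≤ R → |g' r| ≤ 2 * Xm / ℓ ^ 2 := fun r hr => by
    simp only [hg', abs_neg, abs_div, abs_of_pos hℓ2, abs_mul, abs_two]
    have hin : |⟪x j r, deriv (x j) r⟫_ℝ| ≤ ‖x j r‖ := by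
      have := abs_real_inner_le_norm (x j r) (deriv (x j) r); rwa [hunit r, mul_one] at this
    exact div_le_div_of_nonneg_right (by linarith [hXw r hr]) hℓ2.le
  have hg'd : ∀ r, HasDerivAt g' (-(2 * (⟪deriv (x j) r, deriv (x j) r⟫_ℝ + ⟪x j r, deriv (deriv (x j)) r⟫_ℝ) / ℓ ^ 2)) r := fun r => by
    have h := ((hp r).inner ℝ (hT r))
    have h2 := ((h.const_mul 2).div_const (ℓ ^ 2)).neg
    refine (h2.congr_of_eventuallyEq (Eventually.of_forall fun r' => by simp [hg'])).congr_deriv ?_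
    rw [real_inner_comm]; ring
  have hg''b : ∀ r, |r - τ| ≤ R → |-(2 * (⟪deriv (x j) r, deriv (x j) r⟫_ℝ + ⟪x j r, deriv (deriv (x j)) r⟫_ℝ) / ℓ ^ 2)| ≤
      2 * (1 + Xm * κw) / ℓ ^ 2 := fun r hr => by
    rw [abs_neg, abs_div, abs_of_pos hℓ2, abs_mul, abs_two]
    refine div_le_div_of_nonneg_right (mul_le_mul_of_nonneg_left ?_ (by norm_num)) hℓ2.le
    have h1 : ⟪deriv (x j) r, deriv (x j) r⟫_ℝ = 1 := by rw [real_inner_self_eq_norm_sq, hunit r, one_pow]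
    have h2 : |⟪x j r, deriv (deriv (x j)) r⟫_ℝ| ≤ Xm * κw :=
      (abs_real_inner_le_norm _ _).trans (mul_le_mul (hXw r hr) (hκww r hr) (norm_nonneg _) hXm)
    rw [h1]
    calc |1 + ⟪x j r, deriv (deriv (x j)) r⟫_ℝ| ≤ |(1:ℝ)| + |⟪x j r, deriv (deriv (x j)) r⟫_ℝ| := abs_add_le _ _
      _ ≤ 1 + Xm * κw := by rw [abs_one]; linarith
  have hgδ : |g a - g b| ≤ 2 * Xm / ℓ ^ 2 * δ := abs_sub_le_of_hasDerivAt_bound (fun r _ => hgd r) fun r hr => hg'b r (hseg r hr)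
  have hg'δ : |g' a - g' b| ≤ 2 * (1 + Xm * κw) / ℓ ^ 2 * δ :=
    abs_sub_le_of_hasDerivAt_bound (fun r _ => hg'd r) fun r hr => hg''b r (hseg r hr)
  have ha₁d : |deriv Real.smoothTransition (g a) * g' a - deriv Real.smoothTransition (g b) * g' b| ≤ Λ * δ := by
    have hs : deriv Real.smoothTransition (g a) * g' a - deriv Real.smoothTransition (g b) * g' b =
        (deriv Real.smoothTransition (g a) - deriv Real.smoothTransition (g b)) * g' a + deriv Real.smoothTransition (g b) * (g' a - g' b) := by ring
    rw [hs]
    have i1 : |(deriv Real.smoothTransition (g a) - deriv Real.smoothTransition (g b)) * g' a| ≤ D₂ * (2 * Xm / ℓ ^ 2 * δ) * (2 * Xm / ℓ ^ 2) := by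
      rw [abs_mul]
      exact mul_le_mul ((hD₂lip _ _).trans (mul_le_mul_of_nonneg_left hgδ hD₂)) (hg'b a ha) (abs_nonneg _) (by positivity)
    have i2 : |deriv Real.smoothTransition (g b) * (g' a - g' b)| ≤ Cφ * (2 * (1 + Xm * κw) / ℓ ^ 2 * δ) := by
      rw [abs_mul]; exact mul_le_mul (hCφ _) hg'δ (abs_nonneg _) hCφ0
    calc _ ≤ |(deriv Real.smoothTransition (g a) - deriv Real.smoothTransition (g b)) * g' a| + |deriv Real.smoothTransition (g b) * (g' a - g' b)| :=
          abs_add_le _ _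
      _ ≤ D₂ * (2 * Xm / ℓ ^ 2 * δ) * (2 * Xm / ℓ ^ 2) + Cφ * (2 * (1 + Xm * κw) / ℓ ^ 2 * δ) := add_le_add i1 i2
      _ = Λ * δ := by show _ = (D₂ * (2 * Xm / ℓ ^ 2) ^ 2 + Cφ * (2 * (1 + Xm * κw) / ℓ ^ 2)) * δ; ring
  -- assemble with the form lemma
  have hmain := norm_thirdDerivForm_sub_le (b := (liaCoeff Γ γ j)⁻¹) hA₁0 hΛ0 hκw ((norm_nonneg _).trans (hZH a ha)) hM0 hL0 hδ0
    (a₁p := deriv Real.smoothTransition (g a) * g' a) (a₁q := deriv Real.smoothTransition (g b) * g' b)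
    (a₀p := refCutoff ℓ (x j a)) (a₀q := refCutoff ℓ (x j b))
    (Tp := deriv (x j) a) (Tq := deriv (x j) b) (Kp := deriv (deriv (x j)) a) (Kq := deriv (deriv (x j)) b)
    (Wp := W (x j a)) (Wq := W (x j b)) (W1p := fderiv ℝ W (x j a) (deriv (x j) a)) (W1q := fderiv ℝ W (x j b) (deriv (x j) b))
    (hφ₁b b hb) ha₁d (hφ01 b) ha₀d (hunit a).le (hunit b).le hTd (hκww a ha) (hκww b hb) hKd (hWM a ha) hWdiff (hW1 a ha) hW1d
  exact hmain

end Summit.NavierStokesRegularity.NavierStokesRegularity.Theorems.SkeletonJ1RFrame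

end
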